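import Summits.BirchSwinnertonDyer.BirchSwinnertonDyer.Theorems.CMKolyvaginAtInertTwoPointSystemAtTwoOfPrintedInputs
import Summits.BirchSwinnertonDyer.BirchSwinnertonDyer.Theorems.CMKolyvaginAtInertTwoLevelZeroPrimeHeegnerBSDTwo
import HarnessLib

/-!
# Route `CMKolyvaginAtInertTwo`, crux `CMKolyvaginExactAtInertTwo` (stmt-BirchSwinnertonDyer-24277):
# THE H₂ LEVEL-ZERO CLASS THEOREM FROM PRINT — `BSD₂(E)` for every `E ∈ H₂` with a prime Heegner field
# and a `2`-indivisible `y_K`, modulo PRINTED statements and the two PLUMBING binders only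

Seat `bsd-line-cmk2-p1` g9 (cell `bsd-print-cf2`); helper (`--supports stmt-BirchSwinnertonDyer-24277`).
THEOREMS ONLY (no definition, no named fact, no instance, no `sorry`); no item is closed; BSD is not
proved by this.

This is `CMLevelZeroTwo.bsdp_two_of_levelZero_primeHeegner_of_pointSystem_of_plumbing` (p635689) with
its one research input — the `p = 2` point-system DATA `D` (item (0b) of the pen's booking memo
`BOOKING-TARGET-H2-levelzero.md` v2) — DISCHARGED by
`CMPointSystemTwo.nonempty_pointSystemFamily_two_of_cmInert_of_printedInputs` (this seat: Gross §§3–6 /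
McCallum §4 at `p = 2` on H₂ composed from the K7t road of cell `bsd-cm`, x11b3's assembly, bsd-f1-sign2's
Lemma 4.3 at `2`, the gross37 trace relation, Darmon 3.6 rationality and Deuring's `a_ℓ = 0`), so that
what is displayed is PRINT only:

* BSD-side named facts: `exists_isNewformOf` (modularity), `gross_zagier` at every level,
  `rank_eq_analyticRank_of_analyticRank_le_one` (GZK), Milne 1972 Thm. 1 any model
  (`Milne1972.bsdQuotient_baseChange_quadratic_anyModel`), Burungale–Flach
  (`bsdTriple_of_hasCM_of_L_one_ne_zero`);
* Euler-system-side: the named fact `GrossLMS1991.prop37_2_reductionCongruence_inert N_E W K` (Gross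
  Prop. 3.7 (2), image-free), and two cite-only printed statements in the binder shapes of the odd-`p` X11b
  road at `p = 2`: `h53` (Gross Prop. 5.3: `τ y_m = −ε σ' y_m` up to torsion) and `hGZ31` (Gross–Zagier
  III (3.1): the `y_m` meet the identity component at the bad places up to a factor prime to `2`);
* the two PLUMBING binders (tower), (desc-fin) of g8's `…RationalDescentAtTwoDual` (ty2 g22).

* `bsdp_two_of_levelZero_primeHeegner_of_printedInputs_of_plumbing` — for every `W ∈ H₂` (`HasCM`,
  `CMInert W 2`, `ρ̄₂` onto, `r_an = 1`, odd Tamagawa product, globally minimal), every imaginary quadratic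
  `K` with `d_K = −q` (`q` prime) odd `≠ −3` and the Heegner hypothesis for `N_E` (with the place `u` of
  `q`), every frame `Dt` (lattice clause, `Odd Dt.c`), `β`, `ι`, `d₁` with `y_K` of infinite order and
  `y_K ∉ 2E(K[1])`: the prints above + (tower) + (desc-fin) ⟹ **`BSDp W 2`**.

HONEST FRAMING: conditional on the displayed named facts / printed statements (none of the BSD-side five
has a `_holds`; `prop37_2_reductionCongruence_inert`, `h53`, `hGZ31` are print, cite-only) and on the two
plumbing binders; the reciprocity law, Poitou–Tate, Čebotarev, Gross 3.7 (1), Lemma 4.3 at `2`, the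
Kolyvagin classes and the whole `2`-descent are theorems of the tree. Beyond print: NO new mathematics is
claimed — but the STATEMENT (Kolyvagin's `#Ш`-control at `p = 2` for CM curves with `2` inert, level
zero) has no printed counterpart (Kolyvagin/McCallum/Cha/Matar–Nekovář: `p` odd; barrier
`CMRankOneAtNonsplitTwo`); the referee decides the label at booking. BSD is not proved by this; no summit
statement and no item is closed by this file.

References: [GrossLMS1991] §1 (1.2), Prop. 2.1, §3 Props. 3.6–3.7, §4, Props. 5.3, 5.4, 6.2, §10;
[McCallumLMS1991] §1, §2 Prop. 2.2, §4 Prop. 4.4, §5; [GrossZagier1986] I.6.3, III (3.1), V.§2;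
[BurungaleFlach2024] Thm. 1.1, Cor. 2; [Milne1972] Thm. 1; [MilneADT2006] I Thm. 4.10 (b);
[Darmon2004] Thm. 3.6; [Lang1987] Ch. 13 §4 Thm. 12.
-/

-- single-conjunct summit: `Summit.BirchSwinnertonDyer.BirchSwinnertonDyer.…` repeats the name by design
set_option linter.dupNamespace false
set_option autoImplicit false

noncomputable section

open scoped Classical
open WeierstrassCurve NumberField IsDedekindDomain
open Literature.NumberTheory.EllipticCurves Literature.NumberTheory.EllipticCurves.ModularForms
open Literature.NumberTheory.EllipticCurves.Rank1Residual
open Literature.NumberTheory.EllipticCurves.RingClassField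
open Literature.NumberTheory.GaloisRepresentations
open Summit.BirchSwinnertonDyer.Rank1Residual.X11b
open Rat.HeightOneSpectrum (primesEquiv)

namespace Summit.BirchSwinnertonDyer.BirchSwinnertonDyer.Theorems.CMLevelZeroTwo

/-- **THE H₂ LEVEL-ZERO CLASS THEOREM FROM PRINT** (module docstring): the five BSD-side named facts, the
named fact Gross 3.7 (2), the printed statements Gross 5.3 and Gross–Zagier III (3.1), and the two plumbing
binders (tower), (desc-fin) imply `BSD₂(W)` for every `W ∈ H₂` with a prime Heegner field `K = ℚ(√−q)` and a
frame whose `y_K` has infinite order and is not `2`-divisible in `E(K[1])`.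
[cite: GrossLMS1991, §1 (1.2), Prop. 2.1 with §10, Props. 3.7, 5.3, 5.4, 6.2] [cite: McCallumLMS1991, §1
Theorem, §2 Prop. 2.2, §4 Prop. 4.4, §5 Lemma 5.1] [cite: GrossZagier1986, Thm. I.6.3, III (3.1), V.§2]
[cite: BurungaleFlach2024, Thm. 1.1 and Cor. 2] [cite: Milne1972ArithmeticAV, §1 Thm. 1] -/
theorem bsdp_two_of_levelZero_primeHeegner_of_printedInputs_of_plumbing (hmod : exists_isNewformOf)
    (hGZall : ∀ (N : ℕ) [NeZero N] (W : WeierstrassCurve ℚ) (K : Type) [Field K] [NumberField K],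
      gross_zagier N W K)
    (hGZK : rank_eq_analyticRank_of_analyticRank_le_one)
    (hMilne : Milne1972.bsdQuotient_baseChange_quadratic_anyModel)
    (hBF : bsdTriple_of_hasCM_of_L_one_ne_zero)
    (W : WeierstrassCurve ℚ) [W.IsElliptic] [W.IsGloballyMinimal] [NeZero (W.conductorNorm ℤ)]
    (hCM : W.HasCM) (hin : CMInert W 2) (hsurj : W.HasSurjectiveModNGaloisRep (2 : ℤ))
    (hr : W.analyticRank = 1) (hT : Odd W.tamagawaProduct)
    (K : Type) [Field K] [NumberField K] (hK : IsImaginaryQuadratic K) (hodd : Odd (discr K))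
    (h3 : discr K ≠ -3) (hH : SatisfiesHeegnerHypothesis (W.conductorNorm ℤ) K)
    {q : ℕ} (hq : q.Prime) (hd : discr K = -(q : ℤ))
    (u : HeightOneSpectrum (𝓞 ℚ)) (hu : ((primesEquiv u : Nat.Primes) : ℕ) = q)
    (h372 : GrossLMS1991.prop37_2_reductionCongruence_inert (W.conductorNorm ℤ) W K)
    (h53 : ∀ [W.IsElliptic] (_hK : IsImaginaryQuadratic K) (_hH : SatisfiesHeegnerHypothesis (W.conductorNorm ℤ) K)
      (Dt : ModularParametrizationData W (W.conductorNorm ℤ)) (β : ℤ) (ι : K →+* ℂ) {M : ℕ}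
      (_hM : 1 ≤ M) {n : ℕ} (_hn : Squarefree n)
      (_hKol : ∀ q ∈ n.primeFactors, IsKolyvaginPrime (W.conductorNorm ℤ) W K 2 q ∧ FrobEqFrobInfty W K (2 ^ M) q)
      (d : (m : ℕ) → m ∣ n → KolyvaginHeegnerData Dt β ι m) (m : ℕ) (hm : m ∣ n)
      (τm : ringClassField K ι m ≃ₐ[ℚ] ringClassField K ι m),
      (∀ x : ringClassField K ι m, ((τm x : ringClassField K ι m) : ℂ) = starRingEnd ℂ x) →
      ∃ σ' ∈ ringClassGal ι m, IsOfFinAddOrder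
        (pointGalHom W (ringClassField K ι m) τm (d m hm).y -
          (-W.rootNumber) • pointGalHom W (ringClassField K ι m) σ' (d m hm).y))
    (hGZ31 : ∀ [W.IsElliptic] (_hK : IsImaginaryQuadratic K) (_hH : SatisfiesHeegnerHypothesis (W.conductorNorm ℤ) K)
      (Dt : ModularParametrizationData W (W.conductorNorm ℤ)) (β : ℤ) (ι : K →+* ℂ) {M : ℕ} (_hM : 1 ≤ M) {n : ℕ}
      (_hn : Squarefree n)
      (_hKol : ∀ q ∈ n.primeFactors, IsKolyvaginPrime (W.conductorNorm ℤ) W K 2 q ∧ FrobEqFrobInfty W K (2 ^ M) q)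
      (d : (m : ℕ) → m ∣ n → KolyvaginHeegnerData Dt β ι m),
      ∃ n' : ℤ, IsCoprime ((2 ^ M : ℕ) : ℤ) n' ∧
        ∀ (m : ℕ) (hm : m ∣ n) (γ : ringClassField K ι m ≃ₐ[ℚ] ringClassField K ι m),
          γ ∈ ringClassGal ι m → ∀ v : HeightOneSpectrum (𝓞 K),
            ¬ (W.baseChange K).HasGoodReductionAt v →
            n' • pointsMap (W.baseChange K) (v.adicCompletion K)
                ((d m hm).toGeomPoints (pointGalHom W (ringClassField K ι m) γ (d m hm).y)) ∈
              E0Receptacle (W.baseChange K) v ∧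
            ∀ (ℓ : ℕ) (hℓ : ℓ ∈ m.primeFactors)
              (hle : ringClassField K ι (m / ℓ) ≤ ringClassField K ι m),
              n' • pointsMap (W.baseChange K) (v.adicCompletion K)
                  ((d m hm).toGeomPoints (pointGalHom W (ringClassField K ι m) γ
                    (WeierstrassCurve.Affine.Point.map (W' := W)
                      ((RingClassField.inclusion ι hle).restrictScalars ℚ)
                      (d (m / ℓ)
                        ((Nat.div_dvd_of_dvd (Nat.dvd_of_mem_primeFactors hℓ)).trans hm)).y))) ∈
                E0Receptacle (W.baseChange K) v)
    (Dt : ModularParametrizationData W (W.conductorNorm ℤ))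
    (hopt : ∀ z ∈ Dt.L.lattice, ∃ w ∈ periodLattice Dt.f, z = (Dt.c : ℂ) * w) (hc : Odd Dt.c)
    (β : ℤ) (ι : K →+* ℂ) (d₁ : KolyvaginHeegnerData Dt β ι 1) (hy : ¬ IsOfFinAddOrder d₁.derivedPoint)
    (h2 : ¬ ∃ Q : (W.baseChange (ringClassField K ι 1)).toAffine.Point, (2 : ℤ) • Q = d₁.derivedPoint)
    (htower : ∀ (w : HeightOneSpectrum (𝓞 K)) (ξ : galH1Torsion W ((2 ^ 1 : ℕ) : ℤ)),
      ξ ∈ W.torsionLocalKer ((w.under (𝓞 ℚ)).adicCompletion ℚ) ((2 ^ 1 : ℕ) : ℤ) →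
        resTorsion W K ((2 ^ 1 : ℕ) : ℤ) ξ ∈
          (W.baseChange K).torsionLocalKer (w.adicCompletion K) ((2 ^ 1 : ℕ) : ℤ))
    (hdescfin : ∀ (ξ : galH1Torsion W ((2 ^ 1 : ℕ) : ℤ)) (v : HeightOneSpectrum (𝓞 ℚ)), v ≠ u →
      (∀ w : HeightOneSpectrum (𝓞 K), w.under (𝓞 ℚ) = v →
        resTorsion W K ((2 ^ 1 : ℕ) : ℤ) ξ ∈
          selmerLocalKer (W.baseChange K) (w.adicCompletion K) ((2 ^ 1 : ℕ) : ℤ)) →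
      ξ ∈ selmerLocalKer W (v.adicCompletion ℚ) ((2 ^ 1 : ℕ) : ℤ)) :
    BSDp W 2 := by
  refine bsdp_two_of_levelZero_primeHeegner_of_pointSystem_of_plumbing hmod hGZall hGZK hMilne hBF W hCM
    hin hsurj hr hT K hK hodd h3 hH hq hd u hu Dt hopt hc β ι d₁ hy h2 ?_ htower hdescfin
  intro P₀ hP₀
  exact Classical.choice (CMPointSystemTwo.nonempty_pointSystemFamily_two_of_cmInert_of_printedInputs
    (N := W.conductorNorm ℤ) rfl hCM hin hsurj hK hodd h3 hH hP₀ h372 h53 hGZ31 _)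

end Summit.BirchSwinnertonDyer.BirchSwinnertonDyer.Theorems.CMLevelZeroTwo

end
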